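import Summits.Ventures.HSemireg.WedgeHankelRecurrenceGaussHoffmanWielandt

/-!
# Venture HSemireg — **HOFFMAN–WIELANDT, BOTH SIDES, AND ITS COROLLARIES FOR JACOBI MATRICES**: with `F := Σ_{i≤t} (a'_i − a_i)² + 2 Σ_{i<t} (√b'_{i+1} − √b_{i+1})²` (`= ‖J'^s − J^s‖_F²`) and
# increasing zeros `x`, `y` of two positive recurrences of the same size, **`Σ_k (y_k − x_k)² ≤ F ≤ Σ_k (y_{t−k} − x_k)²`** (sorted below, anti-sorted above; the upper bound is the
# anti-monovariant rearrangement), hence `(y_k − x_k)² ≤ F` for each `k`, **`Σ (y_k − x_k)² ≤ Σ (a'_i − a_i)²`** for equal couplings (the `ℓ²` companion of N387's `ℓ¹` bound) and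
# **`Σ (y_k − x_k)² ≤ 2 Σ (√b'_{i+1} − √b_{i+1})²`** for equal diagonals

HONEST FRAMING. Part of the Lean index of the computation cell `pub-hsemireg` (seat p10 gen 47, Sunday typer «UNIFORM-IN-n»).  Real square matrices, `Real.sqrt` and finite sums only; no variety, no
cohomology theory, no sheaf, no Ext group and no semiregularity map is constructed here; nothing here says that HC / HC_CM / HC_AV holds; no Literature fact (unproved `Prop`) is declared or used.
Custodian versions as in `WedgeHankelSiegelIdeal` (1/3).
SOURCES (cited).  A. J. Hoffman, H. W. Wielandt, Duke Math. J. 20 (1953) 37–39, Thm 1 (`min_σ Σ|α_i − β_{σ i}|² ≤ ‖A − B‖² ≤ max_σ Σ|α_i − β_{σ i}|²`); R. Bhatia, *Matrix Analysis* (1997), Thm VI.4.1,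
Problem VI.8.6 (the upper rearrangement); G. H. Hardy, J. E. Littlewood, G. Pólya, *Inequalities*, Thm 368 (oppositely ordered case); J. H. Wilkinson, *The Algebraic Eigenvalue Problem* (1965),
Ch. 2 §48.
PROOF TYPED HERE.  The anti-sorted trace bound `Σ_k x_k y_{t−k} ≤ Σ_{k,l} P_{kl} x_k y_l` (Birkhoff + Mathlib `Antivary.sum_mul_le_sum_mul_comp_perm` with the permutation `σ · rev`); then as in
N417 with the orthogonal `Q, Q'` of N416.  The corollaries are specialisations of N417 `hoffman_wielandt_recurrence` (`√b' = √b`, resp. `a' = a`) and `single term ≤ sum`.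
DEDUP DISCLOSURE (`rg -n -i 'hoffman|wielandt|antivary' Summits/Ventures/HSemireg`, 2026-09-04): N417 (lower bound only); 0 hits for the 6 names below.

WHAT IS IN THE TREE.  N415 `sum_permMatrix_mul_mul`; N416 `symmJacobi_orthogonal_eigen`, `trace_symmJacobi_mul_eq_sum_sq`, `trace_symmJacobi_mul`; N417 `hoffman_wielandt_recurrence`,
`zeros_sq_sum_eq_trace`; Mathlib `exists_eq_sum_perm_of_mem_doublyStochastic`, `Monotone.antivary`, `Antivary.sum_mul_le_sum_mul_comp_perm`, `Fin.rev_anti`, `Fin.revPerm`.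
THIS FILE (namespace `Summit.Ventures.HSemireg.Wedge.HankelOuter` continued; CHAINED on N417; 0 definitions):
* §1183 `sum_mul_rev_le_of_mem_doublyStochastic` (`Σ_k x_k y_{t−k} ≤ Σ_{k,l} P_{kl} x_k y_l`), **`trace_symmJacobi_mul_ge`** (`Σ_k x_k y_{t−k} ≤ Σ a_i a'_i + 2Σ √b √b'`), **`hoffman_wielandt_upper`**
  (`F ≤ Σ_k (y_{t−k} − x_k)²`), `zero_shift_sq_le_frobenius` (`(y_k − x_k)² ≤ F`), **`hoffman_wielandt_diagonal`** (`b' = b`), **`hoffman_wielandt_couplings`** (`a' = a`).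
CAVEATS.  As N417: both recurrences positive, same size, zeros increasing.  Nothing Ext-side.  New names only.
-/

open Module Polynomial
open scoped Matrix Polynomial

namespace Summit.Ventures.HSemireg.Wedge.HankelOuter

/-! ## §1183. Hoffman–Wielandt: the upper rearrangement and the corollaries -/

/-- **Anti-sorted trace bound: `Σ_k x_k y_{t−k} ≤ Σ_{k,l} P_{kl} x_k y_l`** for doubly stochastic `P` and increasing `x, y`. [Hardy–Littlewood–Pólya Thm 368; Bhatia Problem VI.8.6; this file, §1183] -/
theorem sum_mul_rev_le_of_mem_doublyStochastic {n : ℕ} {x y : Fin n → ℝ} (hx : Monotone x) (hy : Monotone y) {P : Matrix (Fin n) (Fin n) ℝ}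
    (hP : P ∈ doublyStochastic ℝ (Fin n)) : ∑ k, x k * y (Fin.rev k) ≤ ∑ k, ∑ l, P k l * (x k * y l) := by
  obtain ⟨w, hw0, hw1, hwP⟩ := exists_eq_sum_perm_of_mem_doublyStochastic hP
  have hexp : ∑ k, ∑ l, P k l * (x k * y l) = ∑ σ, w σ * ∑ k, x k * y (σ k) := by
    rw [← hwP]
    have hkl : ∀ k l, (∑ σ, w σ • σ.permMatrix ℝ) k l * (x k * y l) = ∑ σ, w σ * ((σ.permMatrix ℝ) k l * (x k * y l)) := fun k l => by
      rw [Matrix.sum_apply, Finset.sum_mul]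
      exact Finset.sum_congr rfl fun σ _ => by rw [Matrix.smul_apply, smul_eq_mul, mul_assoc]
    simp_rw [hkl]
    rw [Finset.sum_congr rfl fun k _ => Finset.sum_comm, Finset.sum_comm]
    refine Finset.sum_congr rfl fun σ _ => ?_
    rw [← sum_permMatrix_mul_mul σ x y, Finset.mul_sum]
    exact Finset.sum_congr rfl fun k _ => by rw [Finset.mul_sum]
  rw [hexp]
  have hanti : Antivary x (y ∘ Fin.rev) := hx.antivary (hy.comp_antitone Fin.rev_anti)
  calc ∑ k, x k * y (Fin.rev k) = ∑ σ, w σ * ∑ k, x k * y (Fin.rev k) := by rw [← Finset.sum_mul, hw1, one_mul]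
    _ ≤ ∑ σ, w σ * ∑ k, x k * y (σ k) := Finset.sum_le_sum fun σ _ => mul_le_mul_of_nonneg_left (by
        have h := hanti.sum_mul_le_sum_mul_comp_perm (σ := σ.trans Fin.revPerm)
        simpa only [Function.comp_apply, Equiv.trans_apply, Fin.revPerm_apply, Fin.rev_rev] using h) (hw0 σ)

/-- **`Σ_k x_k y_{t−k} ≤ tr(J^s J'^s) = Σ_{i≤t} a_i a'_i + 2 Σ_{i<t} √b_{i+1} √b'_{i+1}`** (the anti-sorted companion of N417). [Hoffman–Wielandt 1953; this file, §1183] -/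
theorem trace_symmJacobi_mul_ge {q q' : ℕ → ℝ[X]} {a a' b b' : ℕ → ℝ} (hq0 : q 0 = 1) (hq1 : q 1 = Polynomial.X - C (a 0))
    (hrec : ∀ n, q (n + 2) = (Polynomial.X - C (a (n + 1))) * q (n + 1) - C (b (n + 1)) * q n) (hq0' : q' 0 = 1) (hq1' : q' 1 = Polynomial.X - C (a' 0))
    (hrec' : ∀ n, q' (n + 2) = (Polynomial.X - C (a' (n + 1))) * q' (n + 1) - C (b' (n + 1)) * q' n) (hb : ∀ j, 0 < b j) (hb' : ∀ j, 0 < b' j) {t : ℕ}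
    {x y : Fin (t + 1) → ℝ} (hx : StrictMono x) (hxq : q (t + 1) = ∏ k, (Polynomial.X - C (x k))) (hy : StrictMono y) (hyq : q' (t + 1) = ∏ k, (Polynomial.X - C (y k))) :
    ∑ k, x k * y (Fin.rev k) ≤ ∑ i ∈ Finset.range (t + 1), a i * a' i + 2 * ∑ i ∈ Finset.range t, Real.sqrt (b (i + 1)) * Real.sqrt (b' (i + 1)) := by
  set Js : Matrix (Fin (t + 1)) (Fin (t + 1)) ℝ := Matrix.of fun i j : Fin (t + 1) =>
    if (i : ℕ) = j then a i else if (j : ℕ) = i + 1 then Real.sqrt (b j) else if (i : ℕ) = j + 1 then Real.sqrt (b i) else 0 with hJsdef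
  set Js' : Matrix (Fin (t + 1)) (Fin (t + 1)) ℝ := Matrix.of fun i j : Fin (t + 1) =>
    if (i : ℕ) = j then a' i else if (j : ℕ) = i + 1 then Real.sqrt (b' j) else if (i : ℕ) = j + 1 then Real.sqrt (b' i) else 0 with hJs'def
  have hJs : ∀ i j : Fin (t + 1), Js i j = if (i : ℕ) = j then a i else if (j : ℕ) = i + 1 then Real.sqrt (b j) else if (i : ℕ) = j + 1 then Real.sqrt (b i) else 0 :=
    fun i j => by rw [hJsdef, Matrix.of_apply]
  have hJs' : ∀ i j : Fin (t + 1), Js' i j = if (i : ℕ) = j then a' i else if (j : ℕ) = i + 1 then Real.sqrt (b' j) else if (i : ℕ) = j + 1 then Real.sqrt (b' i) else 0 :=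
    fun i j => by rw [hJs'def, Matrix.of_apply]
  obtain ⟨Q, hQ1, hQ2, hQe⟩ := symmJacobi_orthogonal_eigen hq0 hq1 hrec hb hJs hx hxq
  obtain ⟨Q', hQ1', hQ2', hQe'⟩ := symmJacobi_orthogonal_eigen hq0' hq1' hrec' hb' hJs' hy hyq
  rw [← trace_symmJacobi_mul hJs hJs', trace_symmJacobi_mul_eq_sum_sq hQ1 hQe hQ1' hQe']
  have h1 : (Qᵀ * Q') * (Qᵀ * Q')ᵀ = 1 := by rw [Matrix.transpose_mul, Matrix.transpose_transpose, Matrix.mul_assoc, ← Matrix.mul_assoc Q', hQ1', Matrix.one_mul, hQ2]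
  have h2 : (Qᵀ * Q')ᵀ * (Qᵀ * Q') = 1 := by rw [Matrix.transpose_mul, Matrix.transpose_transpose, Matrix.mul_assoc, ← Matrix.mul_assoc Q, hQ1, Matrix.one_mul, hQ2']
  have h := sum_mul_rev_le_of_mem_doublyStochastic hx.monotone hy.monotone (sq_mem_doublyStochastic_of_mul_transpose h1 h2)
  simpa only [Matrix.of_apply] using h

/-- **HOFFMAN–WIELANDT, UPPER REARRANGEMENT: `Σ (a'_i − a_i)² + 2 Σ (√b'_{i+1} − √b_{i+1})² ≤ Σ_k (y_{t−k} − x_k)²`** (the Frobenius distance of the symmetric Jacobi matrices is at most the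
anti-sorted `ℓ²` distance of the node vectors). [Hoffman–Wielandt 1953 Thm 1 (max side); Bhatia Problem VI.8.6; this file, §1183] -/
theorem hoffman_wielandt_upper {q q' : ℕ → ℝ[X]} {a a' b b' : ℕ → ℝ} (hq0 : q 0 = 1) (hq1 : q 1 = Polynomial.X - C (a 0))
    (hrec : ∀ n, q (n + 2) = (Polynomial.X - C (a (n + 1))) * q (n + 1) - C (b (n + 1)) * q n) (hq0' : q' 0 = 1) (hq1' : q' 1 = Polynomial.X - C (a' 0))
    (hrec' : ∀ n, q' (n + 2) = (Polynomial.X - C (a' (n + 1))) * q' (n + 1) - C (b' (n + 1)) * q' n) (hb : ∀ j, 0 < b j) (hb' : ∀ j, 0 < b' j) {t : ℕ}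
    {x y : Fin (t + 1) → ℝ} (hx : StrictMono x) (hxq : q (t + 1) = ∏ k, (Polynomial.X - C (x k))) (hy : StrictMono y) (hyq : q' (t + 1) = ∏ k, (Polynomial.X - C (y k))) :
    ∑ i ∈ Finset.range (t + 1), (a' i - a i) ^ 2 + 2 * ∑ i ∈ Finset.range t, (Real.sqrt (b' (i + 1)) - Real.sqrt (b (i + 1))) ^ 2 ≤ ∑ k, (y (Fin.rev k) - x k) ^ 2 := by
  have hmix := trace_symmJacobi_mul_ge hq0 hq1 hrec hq0' hq1' hrec' hb hb' hx hxq hy hyq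
  have hxx := zeros_sq_sum_eq_trace hq0 hq1 hrec hb hx hxq
  have hyy := zeros_sq_sum_eq_trace hq0' hq1' hrec' hb' hy hyq
  have hyrev : ∑ k, y (Fin.rev k) ^ 2 = ∑ k, y k ^ 2 := Fintype.sum_equiv Fin.revPerm _ _ fun k => by rw [Fin.revPerm_apply]
  have e1 : ∑ k, (y (Fin.rev k) - x k) ^ 2 = ∑ k, y (Fin.rev k) ^ 2 + ∑ k, x k ^ 2 - 2 * ∑ k, x k * y (Fin.rev k) := by
    rw [← Finset.sum_add_distrib, Finset.mul_sum, ← Finset.sum_sub_distrib]; exact Finset.sum_congr rfl fun k _ => by ring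
  have e2 : ∑ i ∈ Finset.range (t + 1), (a' i - a i) ^ 2 = ∑ i ∈ Finset.range (t + 1), a' i ^ 2 + ∑ i ∈ Finset.range (t + 1), a i ^ 2 - 2 * ∑ i ∈ Finset.range (t + 1), a i * a' i := by
    rw [← Finset.sum_add_distrib, Finset.mul_sum, ← Finset.sum_sub_distrib]; exact Finset.sum_congr rfl fun i _ => by ring
  have e3 : ∑ i ∈ Finset.range t, (Real.sqrt (b' (i + 1)) - Real.sqrt (b (i + 1))) ^ 2 =
      ∑ i ∈ Finset.range t, b' (i + 1) + ∑ i ∈ Finset.range t, b (i + 1) - 2 * ∑ i ∈ Finset.range t, Real.sqrt (b (i + 1)) * Real.sqrt (b' (i + 1)) := by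
    rw [← Finset.sum_add_distrib, Finset.mul_sum, ← Finset.sum_sub_distrib]
    exact Finset.sum_congr rfl fun i _ => by
      have h1 := Real.sq_sqrt (hb (i + 1)).le
      have h2 := Real.sq_sqrt (hb' (i + 1)).le
      nlinarith [h1, h2]
  rw [e1, e2, e3, hxx, hyrev, hyy]
  linarith

/-- **Each node moves by at most the Frobenius distance: `(y_k − x_k)² ≤ Σ (a'_i − a_i)² + 2 Σ (√b'_{i+1} − √b_{i+1})²`.** [Hoffman–Wielandt 1953; this file, §1183] -/
theorem zero_shift_sq_le_frobenius {q q' : ℕ → ℝ[X]} {a a' b b' : ℕ → ℝ} (hq0 : q 0 = 1) (hq1 : q 1 = Polynomial.X - C (a 0))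
    (hrec : ∀ n, q (n + 2) = (Polynomial.X - C (a (n + 1))) * q (n + 1) - C (b (n + 1)) * q n) (hq0' : q' 0 = 1) (hq1' : q' 1 = Polynomial.X - C (a' 0))
    (hrec' : ∀ n, q' (n + 2) = (Polynomial.X - C (a' (n + 1))) * q' (n + 1) - C (b' (n + 1)) * q' n) (hb : ∀ j, 0 < b j) (hb' : ∀ j, 0 < b' j) {t : ℕ}
    {x y : Fin (t + 1) → ℝ} (hx : StrictMono x) (hxq : q (t + 1) = ∏ k, (Polynomial.X - C (x k))) (hy : StrictMono y) (hyq : q' (t + 1) = ∏ k, (Polynomial.X - C (y k)))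
    (k : Fin (t + 1)) : (y k - x k) ^ 2 ≤ ∑ i ∈ Finset.range (t + 1), (a' i - a i) ^ 2 + 2 * ∑ i ∈ Finset.range t, (Real.sqrt (b' (i + 1)) - Real.sqrt (b (i + 1))) ^ 2 :=
  (Finset.single_le_sum (f := fun k => (y k - x k) ^ 2) (fun _ _ => sq_nonneg _) (Finset.mem_univ k)).trans
    (hoffman_wielandt_recurrence hq0 hq1 hrec hq0' hq1' hrec' hb hb' hx hxq hy hyq)

/-- **EQUAL COUPLINGS (`ℓ²` diagonal perturbation): `Σ_k (y_k − x_k)² ≤ Σ_{i≤t} (a'_i − a_i)²`** (companion of N387's `ℓ¹` bound). [Hoffman–Wielandt 1953; Wilkinson Ch. 2 §44 ∕ §48; this file,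
§1183] -/
theorem hoffman_wielandt_diagonal {q q' : ℕ → ℝ[X]} {a a' b : ℕ → ℝ} (hq0 : q 0 = 1) (hq1 : q 1 = Polynomial.X - C (a 0))
    (hrec : ∀ n, q (n + 2) = (Polynomial.X - C (a (n + 1))) * q (n + 1) - C (b (n + 1)) * q n) (hq0' : q' 0 = 1) (hq1' : q' 1 = Polynomial.X - C (a' 0))
    (hrec' : ∀ n, q' (n + 2) = (Polynomial.X - C (a' (n + 1))) * q' (n + 1) - C (b (n + 1)) * q' n) (hb : ∀ j, 0 < b j) {t : ℕ}
    {x y : Fin (t + 1) → ℝ} (hx : StrictMono x) (hxq : q (t + 1) = ∏ k, (Polynomial.X - C (x k))) (hy : StrictMono y) (hyq : q' (t + 1) = ∏ k, (Polynomial.X - C (y k))) :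
    ∑ k, (y k - x k) ^ 2 ≤ ∑ i ∈ Finset.range (t + 1), (a' i - a i) ^ 2 := by
  have h := hoffman_wielandt_recurrence hq0 hq1 hrec hq0' hq1' hrec' hb hb hx hxq hy hyq
  simp only [sub_self, zero_pow two_ne_zero, Finset.sum_const_zero, mul_zero, add_zero] at h
  exact h

/-- **EQUAL DIAGONALS: `Σ_k (y_k − x_k)² ≤ 2 Σ_{i<t} (√b'_{i+1} − √b_{i+1})²`.** [Hoffman–Wielandt 1953; this file, §1183] -/
theorem hoffman_wielandt_couplings {q q' : ℕ → ℝ[X]} {a b b' : ℕ → ℝ} (hq0 : q 0 = 1) (hq1 : q 1 = Polynomial.X - C (a 0))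
    (hrec : ∀ n, q (n + 2) = (Polynomial.X - C (a (n + 1))) * q (n + 1) - C (b (n + 1)) * q n) (hq0' : q' 0 = 1) (hq1' : q' 1 = Polynomial.X - C (a 0))
    (hrec' : ∀ n, q' (n + 2) = (Polynomial.X - C (a (n + 1))) * q' (n + 1) - C (b' (n + 1)) * q' n) (hb : ∀ j, 0 < b j) (hb' : ∀ j, 0 < b' j) {t : ℕ}
    {x y : Fin (t + 1) → ℝ} (hx : StrictMono x) (hxq : q (t + 1) = ∏ k, (Polynomial.X - C (x k))) (hy : StrictMono y) (hyq : q' (t + 1) = ∏ k, (Polynomial.X - C (y k))) :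
    ∑ k, (y k - x k) ^ 2 ≤ 2 * ∑ i ∈ Finset.range t, (Real.sqrt (b' (i + 1)) - Real.sqrt (b (i + 1))) ^ 2 := by
  have h := hoffman_wielandt_recurrence hq0 hq1 hrec hq0' hq1' hrec' hb hb' hx hxq hy hyq
  simp only [sub_self, zero_pow two_ne_zero, Finset.sum_const_zero, zero_add] at h
  exact h

end Summit.Ventures.HSemireg.Wedge.HankelOuter
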